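import Mathlib.MeasureTheory.Group.ModularCharacter
import Mathlib.GroupTheory.Commutator.Basic

/-!
# Perfect locally compact groups are unimodular

The support map's sentence «the group is unimodular» (N4.3 / B1) is, for a NON-compact group, the
statement that its modular character is trivial.  Mathlib (2025) has the modular character
`MeasureTheory.Measure.modularCharacter : G →* ℝ≥0` of a locally compact group, with
`map (· * g) μ = modularCharacterFun g • μ` for every inner regular left Haar measure `μ`.

Here: a homomorphism from a group to a COMMUTATIVE monoid kills every commutator, hence the
commutator subgroup; so a PERFECT group (`commutator G = ⊤`) has trivial modular character, and
every (inner regular, or regular, or second-countable) left Haar measure on a perfect locally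
compact group is right-invariant and inversion-invariant.  `T5SL2Perfect` shows
`commutator (SL (Fin 2) F) = ⊤` for a field of characteristic zero and `T5SL2Unimodular`
instantiates the present file at `SL (Fin 2) ℝ`.

Blind lane: Mathlib only; no sorry; axioms ⊆ {propext, Classical.choice, Quot.sound}.
-/

namespace Summit.Ventures.HodgeRepro2.T5UnimodularPerfect

open MeasureTheory MeasureTheory.Measure
open scoped NNReal ENNReal commutatorElement

section algebra

variable {G M : Type*} [Group G] [CommMonoid M]

/-- A homomorphism from a group to a commutative monoid kills every commutator
`⁅g, h⁆ = g h g⁻¹ h⁻¹`. -/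
theorem map_commutatorElement_eq_one (f : G →* M) (g h : G) : f ⁅g, h⁆ = 1 := by
  rw [commutatorElement_def, map_mul, map_mul, map_mul, mul_right_comm (f g) (f h) (f g⁻¹),
    ← map_mul, mul_inv_cancel, map_one, one_mul, ← map_mul, mul_inv_cancel, map_one]

/-- The commutator subgroup lies in the kernel of every homomorphism to a commutative monoid. -/
theorem commutator_le_ker (f : G →* M) : commutator G ≤ f.ker := by
  rw [commutator_def, Subgroup.commutator_le]
  intro g _ h _
  exact MonoidHom.mem_ker.mpr (map_commutatorElement_eq_one f g h)

/-- A homomorphism to a commutative monoid is `1` on the commutator subgroup. -/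
theorem map_eq_one_of_mem_commutator (f : G →* M) {g : G} (hg : g ∈ commutator G) : f g = 1 :=
  MonoidHom.mem_ker.mp (commutator_le_ker f hg)

/-- A PERFECT group (`commutator G = ⊤`) admits no non-trivial homomorphism to a commutative
monoid. -/
theorem map_eq_one_of_commutator_eq_top (hG : commutator G = ⊤) (f : G →* M) (g : G) :
    f g = 1 :=
  map_eq_one_of_mem_commutator f (hG ▸ Subgroup.mem_top g)

end algebra

section modular

variable {G : Type*} [Group G] [TopologicalSpace G] [IsTopologicalGroup G] [LocallyCompactSpace G]

/-- The modular character of a locally compact group is `1` on every commutator. -/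
theorem modularCharacterFun_commutatorElement (g h : G) : modularCharacterFun ⁅g, h⁆ = 1 :=
  map_commutatorElement_eq_one (modularCharacter (G := G)) g h

/-- The modular character of a locally compact group is `1` on the commutator subgroup. -/
theorem modularCharacterFun_eq_one_of_mem_commutator {g : G} (hg : g ∈ commutator G) :
    modularCharacterFun g = 1 :=
  map_eq_one_of_mem_commutator (modularCharacter (G := G)) hg

/-- **A perfect locally compact group has trivial modular character.** -/
theorem modularCharacterFun_eq_one_of_commutator_eq_top (hG : commutator G = ⊤) (g : G) :
    modularCharacterFun g = 1 :=
  map_eq_one_of_commutator_eq_top hG (modularCharacter (G := G)) g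

/-- The same as an equality of homomorphisms: `modularCharacter = 1`. -/
theorem modularCharacter_eq_one_of_commutator_eq_top (hG : commutator G = ⊤) :
    (modularCharacter : G →* ℝ≥0) = 1 :=
  MonoidHom.ext fun g => modularCharacterFun_eq_one_of_commutator_eq_top hG g

variable [MeasurableSpace G] [BorelSpace G]

/-- **A perfect locally compact group is unimodular**: every inner regular left Haar measure is
right-invariant (`map (· * g) μ = modularCharacterFun g • μ = μ`). -/
theorem isMulRightInvariant_of_commutator_eq_top (hG : commutator G = ⊤) (μ : Measure G)
    [IsHaarMeasure μ] [InnerRegular μ] : IsMulRightInvariant μ := by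
  refine ⟨fun g => ?_⟩
  rw [map_right_mul_eq_modularCharacterFun_smul μ g,
    modularCharacterFun_eq_one_of_commutator_eq_top hG, one_smul]

/-- The second-countable form: every left Haar measure on a perfect, second countable, locally
compact group is right-invariant (uniqueness `isMulLeftInvariant_eq_smul` needs no regularity). -/
theorem isMulRightInvariant_of_commutator_eq_top_of_secondCountable [SecondCountableTopology G]
    (hG : commutator G = ⊤) (μ : Measure G) [IsHaarMeasure μ] : IsMulRightInvariant μ := by
  refine ⟨fun g => ?_⟩
  rw [isMulLeftInvariant_eq_smul (map (· * g) μ) μ, ← modularCharacterFun_eq_haarScalarFactor μ g,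
    modularCharacterFun_eq_one_of_commutator_eq_top hG, one_smul]

/-- Right translation preserves an inner regular Haar measure on a perfect group. -/
theorem measurePreserving_mul_right_of_commutator_eq_top (hG : commutator G = ⊤) (μ : Measure G)
    [IsHaarMeasure μ] [InnerRegular μ] (g : G) : MeasurePreserving (· * g) μ μ :=
  haveI := isMulRightInvariant_of_commutator_eq_top hG μ
  measurePreserving_mul_right μ g

/-- **Unimodular ⇒ inversion-invariant**: an inner regular left Haar measure that is also
right-invariant is invariant under `g ↦ g⁻¹` (the argument of Mathlib's
`IsHaarMeasure.isInvInvariant_of_innerRegular`, with right-invariance replacing commutativity: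
`μ.inv` is then a left-invariant Haar measure, so `μ.inv = c • μ`, and `c² = 1`). -/
theorem isInvInvariant_of_isMulRightInvariant (μ : Measure G) [IsHaarMeasure μ] [InnerRegular μ]
    [IsMulRightInvariant μ] : IsInvInvariant μ := by
  constructor
  let c : ℝ≥0∞ := haarScalarFactor μ.inv μ
  have hc : μ.inv = c • μ := isMulLeftInvariant_eq_smul_of_innerRegular μ.inv μ
  have : map Inv.inv (map Inv.inv μ) = c ^ 2 • μ := by
    rw [← inv_def μ, hc, Measure.map_smul, ← inv_def μ, hc, smul_smul, pow_two]
  have μeq : μ = c ^ 2 • μ := by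
    rw [map_map continuous_inv.measurable continuous_inv.measurable] at this
    simpa only [inv_involutive, Function.Involutive.comp_self, Measure.map_id]
  have K : TopologicalSpace.PositiveCompacts G := Classical.arbitrary _
  have : c ^ 2 * μ K = 1 ^ 2 * μ K := by
    conv_rhs => rw [μeq]
    simp
  have : c ^ 2 = 1 ^ 2 :=
    (ENNReal.mul_left_inj (measure_pos_of_nonempty_interior _ K.interior_nonempty).ne'
          K.isCompact.measure_lt_top.ne).1 this
  have : c = 1 := (ENNReal.pow_right_strictMono two_ne_zero).injective this
  rw [hc, this, one_smul]

/-- Every inner regular left Haar measure on a perfect locally compact group is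
inversion-invariant. -/
theorem isInvInvariant_of_commutator_eq_top (hG : commutator G = ⊤) (μ : Measure G)
    [IsHaarMeasure μ] [InnerRegular μ] : IsInvInvariant μ :=
  haveI := isMulRightInvariant_of_commutator_eq_top hG μ
  isInvInvariant_of_isMulRightInvariant μ

/-- The integral form of unimodularity: `∫ f (x * g) ∂μ = ∫ f x ∂μ` on a perfect group. -/
theorem integral_mul_right_of_commutator_eq_top (hG : commutator G = ⊤) (μ : Measure G)
    [IsHaarMeasure μ] [InnerRegular μ] {E : Type*} [NormedAddCommGroup E] [NormedSpace ℝ E]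
    (f : G → E) (g : G) : ∫ x, f (x * g) ∂μ = ∫ x, f x ∂μ :=
  haveI := isMulRightInvariant_of_commutator_eq_top hG μ
  integral_mul_right_eq_self f g

/-- The integral form of inversion-invariance: `∫ f x⁻¹ ∂μ = ∫ f x ∂μ` on a perfect group. -/
theorem integral_inv_of_commutator_eq_top (hG : commutator G = ⊤) (μ : Measure G)
    [IsHaarMeasure μ] [InnerRegular μ] {E : Type*} [NormedAddCommGroup E] [NormedSpace ℝ E]
    (f : G → E) : ∫ x, f x⁻¹ ∂μ = ∫ x, f x ∂μ :=
  haveI := isInvInvariant_of_commutator_eq_top hG μ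
  integral_inv_eq_self f μ

end modular

end Summit.Ventures.HodgeRepro2.T5UnimodularPerfect
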